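import Mathlib
import HarnessLib
import Summits.ValiantsHypothesis.ValiantsHypothesis.Theses.MonotoneRestoration
import Literature.Computability.AlgebraicComplexity.ArithCircuit
import Literature.Computability.AlgebraicComplexity.ArithCircuitProofs
import Literature.Computability.AlgebraicComplexity.MonotoneStructure
import Literature.Computability.AlgebraicComplexity.PermanentIrreducible
import Literature.ModelTheory.FiniteModelTheory.CkEquiv
import Summits.ValiantsHypothesis.ValiantsHypothesis.Theorems.MonotoneRestorationMonotoneRestorationQPCosetCount
import Summits.ValiantsHypothesis.ValiantsHypothesis.Theorems.MonotoneRestorationMonotoneRestorationQPSymmetricLB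
import Summits.ValiantsHypothesis.ValiantsHypothesis.Theorems.MonotoneRestorationMonotoneRestorationQPSupportSymmetrisation
import Summits.ValiantsHypothesis.ValiantsHypothesis.Theorems.MonotoneRestorationMonotoneRestorationQPSparseRegime
import Summits.ValiantsHypothesis.ValiantsHypothesis.Theorems.MonotoneRestorationMonotoneRestorationQPBeta
import Literature.Computability.AlgebraicComplexity.SymmetricArithCircuit
import Literature.Computability.AlgebraicComplexity.DawarWilsenach2025Proofs
import Literature.GroupTheory.PermutationGroups.SmallIndexSubgroups
import Literature.GroupTheory.PermutationGroups.SmallIndexSubgroupsAlternating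
import Summits.ValiantsHypothesis.ValiantsHypothesis.Theorems.MonotoneRestorationQP.Negative.LoadBearing
import Summits.ValiantsHypothesis.ValiantsHypothesis.Theorems.MonotoneRestorationMonotoneRestorationQPPermSupportCount

/-! TTRL-lite variant V19040 of stmt-ValiantsHypothesis-15886

Jordan's bound (Dixon–Mortimer, *Permutation Groups*, Thm 5.2A with `r = 1`; Rotman 1995,
Cor 3.15 with Thm 3.11): for `m ≥ 5` the alternating group `Alt(Fin m)` has no proper subgroup
of index `< m`.  This is the `β = Fin m` specialisation of the tree's
`Literature.GroupTheory.PermutationGroups.alternatingGroup_subgroup_eq_top_of_index_lt_card`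
(normal core `⊥` or `⊤` by simplicity of `Alt`; `⊥` would embed `Alt(m)` in `Sym(m-1)`,
but `m!/2 > (m-1)!`).
-/

-- `Summit.ValiantsHypothesis.ValiantsHypothesis.…` is the tree's mandated single-conjunct layout
-- (Sub = Summit), so the duplicated namespace component is intended.
set_option linter.dupNamespace false

namespace Summit.ValiantsHypothesis.ValiantsHypothesis.Theorems

open Summit.ValiantsHypothesis.ValiantsHypothesis.Theses.MonotoneRestoration
open Literature.Computability.AlgebraicComplexity

/-- **Jordan's bound on `Fin m`** (TTRL-lite variant V19040 of `stub_altFixing_orbit_dichotomy`,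
item stmt-ValiantsHypothesis-15886): if `5 ≤ m`, every subgroup of `alternatingGroup (Fin m)` of
index `< m` is the whole group.  Specialisation of
`Literature.GroupTheory.PermutationGroups.alternatingGroup_subgroup_eq_top_of_index_lt_card`
to `β = Fin m` (`Fintype.card_fin`).
[cite: DixonMortimer1996, Thm 5.2A (r = 1); Rotman1995, Thm 3.11, Cor 3.15] -/
theorem stub_altFixing_orbit_dichotomy_var19040 :
    ∀ (m : ℕ), 5 ≤ m → ∀ H : Subgroup ↥(alternatingGroup (Fin m)), H.index < m → H = ⊤ := by
  intro m hm H hH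
  exact Literature.GroupTheory.PermutationGroups.alternatingGroup_subgroup_eq_top_of_index_lt_card
    (β := Fin m) (by simpa using hm) H (by simpa using hH)

end Summit.ValiantsHypothesis.ValiantsHypothesis.Theorems
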